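import Literature.Barriers.Schanuel.EFunctionValuesAtAlgebraicPointsShidlovskii
import Literature.Barriers.Schanuel.EFunctionValuesAtAlgebraicPointsLemma3
import Literature.Barriers.Schanuel.EFunctionValuesAtAlgebraicPointsSiegelStep
import Literature.Barriers.Schanuel.EFunctionValuesAtAlgebraicPointsAnalytic
import HarnessLib

/-!
# Barrier (Schanuel) `EFunctionValuesAtAlgebraicPoints`: Baker's Lemma 4, raw form — proofs only

`Literature/Barriers/Schanuel/EFunctionValuesAtAlgebraicPointsLemma4Core.lean` — sibling file of
`EFunctionValuesAtAlgebraicPoints.lean` in the programme to discharge `siegelShidlovskii_algIndep`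
(Siegel–Shidlovskii; Rivoal Thm. 5.10 = Baker Thm. 11.1). It assembles Lemmas 1–3 of Baker,
*Transcendental Number Theory*, Ch. 11 with the size bookkeeping and the analytic estimate into
the RAW form of Lemma 4 (p. 112; Rivoal Prop. 5.17): for `r` beyond an explicit threshold there
are algebraic integers `qᵢⱼ = lᴸ P_{i,J(j)}(α)` forming a non-zero determinant, with explicit
(not yet simplified) bounds for their houses and for `|∑ᵢ σ₀(qᵢⱼ) Fᵢ(σ₀α)|` in terms of `r`,
`r!`, `⌊εr⌋` and the constants of the data. The simplification of these bounds to
`(r!)^{1+ε}` and `(r!)^{−(ν−1)+ε}` is done in the sequel file.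

* `SiegelShidlovskii.series_ne_zero` — each `E`-function of an independent system is non-zero;
* `SiegelShidlovskii.lemma4_core` — the raw Lemma 4.

All [folklore] glue; no named facts.

## References

* A. Baker, *Transcendental Number Theory*, CUP 1975, Ch. 11 §3, Lemma 4 (p. 112).
* [Rivoal2024] T. Rivoal, *Les E-fonctions et G-fonctions de Siegel* (2024), Prop. 5.17.
-/

noncomputable section

open Polynomial NumberField Matrix
open scoped Nat

namespace Literature.Barriers.Schanuel

namespace SiegelShidlovskii

variable {K : Type*} [Field K] [NumberField K] {ν : ℕ}

/-- In a `K[X]`-independent system every `Eᵢ` is non-zero. [folklore] -/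
theorem series_ne_zero {E : Fin ν → PowerSeries K}
    (hind : ∀ p : Fin ν → K[X], form (coeAlgHom K) E p = 0 → p = 0) (i : Fin ν) : E i ≠ 0 := by
  classical
  intro h
  have := hind (Pi.single i 1) (by rw [form_single, h, mul_zero])
  have := congr_fun this i
  simp at this

/-- The data of Baker's Lemma 4 bundled: strict `E`-function data with an integral differential
system, `K[X]`-independence, and a point `α` with `α f(α) ≠ 0` and denominator `l`.
[folklore] -/
structure L4Data (K : Type*) [Field K] [NumberField K] (ν : ℕ) extends EData K ν where
  /-- the common denominator of the system -/
  f : K[X]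
  /-- the numerators of the system -/
  G : Matrix (Fin ν) (Fin ν) K[X]
  f_integral : ∀ s, IsIntegral ℤ (f.coeff s)
  G_integral : ∀ h i s, IsIntegral ℤ ((G h i).coeff s)
  sol : IsSol (coeAlgHom K) (PowerSeries.derivative K) f G (fun i => egf (a i))
  indep : ∀ p : Fin ν → K[X], form (coeAlgHom K) (fun i => egf (a i)) p = 0 → p = 0
  /-- the point -/
  α : K
  α_ne_zero : α ≠ 0
  eval_ne_zero : f.eval α ≠ 0
  /-- the denominator of `α` -/
  l : ℕ
  one_le_l : 1 ≤ l
  lα_integral : IsIntegral ℤ ((l : K) * α)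

namespace L4Data

variable (Λ : L4Data K ν)

/-- `f ≠ 0`. [folklore] -/
theorem f_ne_zero : Λ.f ≠ 0 := fun h => Λ.eval_ne_zero (by rw [h, eval_zero])

/-- The `E`-functions as power series. [folklore] -/
abbrev E : Fin ν → PowerSeries K := fun i => egf (Λ.a i)

end L4Data

/-- **Baker's Lemma 4, raw form.** See the module docstring; all constants are explicit.
Inputs: the Siegel constant `cK` (uniform Siegel lemma), the Shidlovskii constant `C₀`,
coefficient-house bounds `hF, hG` for `f, G`, an `ε ∈ (0, 1/4]` and `r` beyond the stated
thresholds; `c₄ = ν² m + ord₀ E₀`, `Jmax = ν + ⌊εr⌋ + c₄`, `L = r + Jmax·m`,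
`M = ν(r+1) − 1 − ⌊εr⌋`, `W = r! · cK (cK ν(r+1) (2C²)^M)^{M/(ν(r+1)−M)} · (cg (L+m+1)^{m+1})^{Jmax}`
with `cg = max 1 (hF + ν hG)`. Output: `qᵢⱼ ∈ 𝓞 K` with `det ≠ 0`,
`house qᵢⱼ ≤ lᴸ (L+1) W max(1, house α)ᴸ` and
`‖∑ᵢ σ₀(qᵢⱼ) Fᵢ(σ₀α)‖ ≤ lᴸ ν W C x^{M−Jmax}/(M−Jmax)! eˣ`, `x = (C+1)‖σ₀α‖`. [folklore] -/
theorem lemma4_core (Λ : L4Data K ν) (hν : 1 ≤ ν) (σ₀ : K →+* ℂ)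
    {cK : ℝ} (hcK1 : 1 ≤ cK)
    (hcK : ∀ (p q : ℕ), 0 < p → p < q →
      ∀ (a : Matrix (Fin p) (Fin q) (𝓞 K)) (A : ℝ), 1 ≤ A →
        (∀ k l, house ((a k l : K)) ≤ A) →
        ∃ ξ : Fin q → 𝓞 K, ξ ≠ 0 ∧ a *ᵥ ξ = 0 ∧
          ∀ l, house ((ξ l : K)) ≤ cK * (cK * q * A) ^ ((p : ℝ) / (q - p)))
    {C₀ : ℕ} (hC₀ : ∀ (r : ℕ) (P : Fin ν → K[X]), P ≠ 0 → (∀ i, (P i).natDegree ≤ r) →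
      (((ν - 1) * r + C₀ : ℕ) : ℕ∞) < (form (coeAlgHom K) Λ.E P).order → Δ Λ.f Λ.G P ≠ 0)
    {hF hG : ℝ} (hfc : CoeffHouseLE Λ.f hF) (hGc : ∀ h i, CoeffHouseLE (Λ.G h i) hG) (hG0 : 0 ≤ hG)
    {ε : ℝ} (hε0 : 0 < ε) (hε1 : ε ≤ 1 / 4)
    (r : ℕ) (hr1 : 2 ≤ r) (hr2 : 2 * C₀ + 2 ≤ r)
    (hr3 : 2 * (ν * ν * sysDeg Λ.f Λ.G + ((egf (Λ.a ⟨0, hν⟩)).order).toNat) + 2 ≤ r) :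
    let m := sysDeg Λ.f Λ.G
    let c₄ := ν * ν * m + ((egf (Λ.a ⟨0, hν⟩)).order).toNat
    let Jmax := ν + (⌊ε * r⌋₊ + c₄)
    let L := r + Jmax * m
    let M := ν * (r + 1) - 1 - ⌊ε * r⌋₊
    let W : ℝ := (r ! : ℝ) * (cK * (cK * (ν * (r + 1) : ℕ) * (2 * Λ.C ^ 2) ^ M) ^
        ((M : ℝ) / ((ν * (r + 1) : ℕ) - M))) *
        (max 1 (hF + ν * hG) * ((L + m + 1 : ℕ) : ℝ) ^ (m + 1)) ^ Jmax
    ∃ q : Fin ν → Fin ν → K,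
      (∀ i j, IsIntegral ℤ (q i j)) ∧ (Matrix.of q).det ≠ 0 ∧
      (∀ i j, house (q i j) ≤ (Λ.l : ℝ) ^ L * ((L : ℝ) + 1) * W * max 1 (house Λ.α) ^ L) ∧
      (∀ j, ‖∑ i, σ₀ (q i j) * eSeries (σ₀ ∘ Λ.a i) (σ₀ Λ.α)‖ ≤
        (Λ.l : ℝ) ^ L * (ν * W * Λ.C * (((Λ.C + 1) * ‖σ₀ Λ.α‖) ^ (M - Jmax) /
          ((M - Jmax)! : ℝ) * Real.exp ((Λ.C + 1) * ‖σ₀ Λ.α‖)))) := by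
  intro m c₄ Jmax L M W
  classical
  -- Step 1: the parameters
  have hfloor : ⌊ε * r⌋₊ ≤ r / 4 := by
    have h1 : (⌊ε * r⌋₊ : ℝ) ≤ ε * r := Nat.floor_le (by positivity)
    have h2 : ε * r ≤ (r : ℝ) / 4 := by
      rw [div_eq_mul_one_div, mul_comm (r : ℝ)]; exact mul_le_mul_of_nonneg_right hε1 (Nat.cast_nonneg _)
    have h3 : (⌊ε * r⌋₊ : ℝ) ≤ (r : ℝ) / 4 := h1.trans h2
    have h4 : (4 * ⌊ε * r⌋₊ : ℝ) ≤ r := by linarith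
    have h5 : 4 * ⌊ε * r⌋₊ ≤ r := by exact_mod_cast h4
    omega
  have hMpos : 0 < M := by
    show 0 < ν * (r + 1) - 1 - ⌊ε * r⌋₊
    have : ν * (r + 1) ≥ r + 1 := by nlinarith
    omega
  have hMN : M < ν * (r + 1) := by
    show ν * (r + 1) - 1 - ⌊ε * r⌋₊ < ν * (r + 1)
    have : ν * (r + 1) ≥ 1 := by nlinarith
    omega
  have hMeq : M + 1 + ⌊ε * r⌋₊ = ν * (r + 1) := by
    show ν * (r + 1) - 1 - ⌊ε * r⌋₊ + 1 + ⌊ε * r⌋₊ = ν * (r + 1)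
    have : ν * (r + 1) ≥ r + 1 := by nlinarith
    omega
  -- Step 2: Lemma 1 (the auxiliary forms)
  obtain ⟨P, hP0, hPdeg, hPint, hPwt, hPord⟩ :=
    exists_aux_forms Λ.toEData hcK1 hcK r M hMpos hMN
  -- Step 3: Lemma 2 (Shidlovskii): `Δ ≠ 0`
  have hΔ : Δ Λ.f Λ.G P ≠ 0 := by
    refine hC₀ r P hP0 hPdeg (lt_of_lt_of_le ?_ hPord)
    have : (ν - 1) * r + C₀ < M := by
      have h1 : ν * (r + 1) = (ν - 1) * (r + 1) + (r + 1) := by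
        obtain ⟨ν', hν'⟩ := Nat.exists_eq_succ_of_ne_zero (by omega : ν ≠ 0)
        subst hν'; simp [Nat.succ_mul]
      have h2 : (ν - 1) * (r + 1) = (ν - 1) * r + (ν - 1) := by ring
      change (ν - 1) * r + C₀ < ν * (r + 1) - 1 - ⌊ε * r⌋₊
      omega
    exact_mod_cast this
  -- Step 4: Lemma 3: the indices `J(j)` and the bound on `t`
  obtain ⟨Jsel, hJinj, hdet⟩ := exists_det_eval_kryVec_ne_zero Λ.f Λ.G P Λ.eval_ne_zero hΔ
  have hE0 : egf (Λ.a ⟨0, hν⟩) ≠ 0 := series_ne_zero Λ.indep ⟨0, hν⟩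
  have htb := rootMultiplicity_add_le Λ.f Λ.G Λ.E Λ.sol (i₀ := ⟨0, hν⟩) hE0 P hPdeg hΔ
    Λ.α_ne_zero M hPord
  have ht_le : (Δ Λ.f Λ.G P).rootMultiplicity Λ.α ≤ ⌊ε * r⌋₊ + c₄ := by
    have h := htb
    change (Δ Λ.f Λ.G P).rootMultiplicity Λ.α + M ≤
      ν * r + ν * ν * m + (ν - 1) + ((egf (Λ.a ⟨0, hν⟩)).order).toNat at h
    change (Δ Λ.f Λ.G P).rootMultiplicity Λ.α ≤
      ⌊ε * r⌋₊ + (ν * ν * m + ((egf (Λ.a ⟨0, hν⟩)).order).toNat)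
    have : ν * (r + 1) = ν * r + ν := by ring
    omega
  have hJ_le : ∀ j, (Jsel j : ℕ) ≤ Jmax := by
    intro j
    have := (Jsel j).isLt
    change (Jsel j : ℕ) ≤ ν + (⌊ε * r⌋₊ + c₄)
    omega
  have hJmaxM : Jmax ≤ M := by
    change ν + (⌊ε * r⌋₊ + c₄) ≤ ν * (r + 1) - 1 - ⌊ε * r⌋₊
    change 2 * (ν * ν * m + ((egf (Λ.a ⟨0, hν⟩)).order).toNat) + 2 ≤ r at hr3
    have : ν * (r + 1) ≥ r + ν := by nlinarith
    omega
  -- Step 5: the `q`'s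
  set q : Fin ν → Fin ν → K := fun i j =>
    (Λ.l : K) ^ L * (kryVec Λ.f Λ.G P (Jsel j) i).eval Λ.α with hq
  have hdegJ : ∀ j i, (kryVec Λ.f Λ.G P (Jsel j) i).natDegree ≤ L := by
    intro j i
    refine (natDegree_dualD_iterate_le Λ.f Λ.G hPdeg _ i).trans ?_
    change r + (Jsel j : ℕ) * m ≤ r + Jmax * m
    exact Nat.add_le_add_left (Nat.mul_le_mul_right _ (hJ_le j)) _
  -- Step 6: factorial weights of the derived vectors, uniformised to `Jmax`
  have hF0 : 0 ≤ hF := hfc.nonneg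
  have hcg1 : (1 : ℝ) ≤ max 1 (hF + ν * hG) := le_max_left _ _
  have hW₀ : 0 ≤ (r ! : ℝ) * (cK * (cK * (ν * (r + 1) : ℕ) * (2 * Λ.C ^ 2) ^ M) ^
      ((M : ℝ) / ((ν * (r + 1) : ℕ) - M))) := by
    rcases Nat.eq_zero_or_pos ν with h | h
    · omega
    · exact (hPwt ⟨0, h⟩).nonneg
  have hbase2 : (1 : ℝ) ≤ max 1 (hF + ν * hG) * ((L + m + 1 : ℕ) : ℝ) ^ (m + 1) :=
    one_le_mul_of_one_le_of_one_le hcg1 (one_le_pow₀ (by exact_mod_cast Nat.succ_le_succ (Nat.zero_le _)))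
  have hwt : ∀ j i, FactWtLE (kryVec Λ.f Λ.G P (Jsel j) i) W := by
    intro j i
    have h := factWtLE_dualD_iterate hfc hGc hG0 hPwt hPdeg (Jsel j : ℕ) i
    refine h.mono ?_
    change _ ≤ (r ! : ℝ) * (cK * (cK * (ν * (r + 1) : ℕ) * (2 * Λ.C ^ 2) ^ M) ^
        ((M : ℝ) / ((ν * (r + 1) : ℕ) - M))) *
        (max 1 (hF + ν * hG) * ((L + m + 1 : ℕ) : ℝ) ^ (m + 1)) ^ Jmax
    rw [mul_comm _ ((max 1 (hF + ν * hG) * ((L + m + 1 : ℕ) : ℝ) ^ (m + 1)) ^ Jmax)]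
    refine mul_le_mul_of_nonneg_right ?_ hW₀
    have hb1 : (hF + ν * hG) * ((r + (Jsel j : ℕ) * sysDeg Λ.f Λ.G + sysDeg Λ.f Λ.G + 1 : ℕ) : ℝ) ^
        (sysDeg Λ.f Λ.G + 1) ≤ max 1 (hF + ν * hG) * ((L + m + 1 : ℕ) : ℝ) ^ (m + 1) := by
      refine mul_le_mul (le_max_right _ _) ?_ (by positivity) (le_trans zero_le_one hcg1)
      change ((r + (Jsel j : ℕ) * m + m + 1 : ℕ) : ℝ) ^ (m + 1) ≤ ((L + m + 1 : ℕ) : ℝ) ^ (m + 1)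
      refine pow_le_pow_left₀ (Nat.cast_nonneg _) ?_ _
      have : r + (Jsel j : ℕ) * m ≤ L := by
        change r + (Jsel j : ℕ) * m ≤ r + Jmax * m
        exact Nat.add_le_add_left (Nat.mul_le_mul_right _ (hJ_le j)) _
      exact_mod_cast (by omega : r + (Jsel j : ℕ) * m + m + 1 ≤ L + m + 1)
    calc ((hF + ν * hG) * ((r + (Jsel j : ℕ) * sysDeg Λ.f Λ.G + sysDeg Λ.f Λ.G + 1 : ℕ) : ℝ) ^
          (sysDeg Λ.f Λ.G + 1)) ^ (Jsel j : ℕ)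
        ≤ (max 1 (hF + ν * hG) * ((L + m + 1 : ℕ) : ℝ) ^ (m + 1)) ^ (Jsel j : ℕ) :=
          pow_le_pow_left₀ (by positivity) hb1 _
      _ ≤ (max 1 (hF + ν * hG) * ((L + m + 1 : ℕ) : ℝ) ^ (m + 1)) ^ Jmax :=
          pow_le_pow_right₀ hbase2 (hJ_le j)
  have hWnn : 0 ≤ W := by
    rcases Nat.eq_zero_or_pos ν with h | h
    · omega
    · exact (hwt ⟨0, h⟩ ⟨0, h⟩).nonneg
  refine ⟨q, fun i j => ?_, ?_, fun i j => ?_, fun j => ?_⟩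
  · -- integrality
    exact isIntegral_pow_mul_eval
      (isIntegral_coeff_dualD_iterate Λ.f_integral Λ.G_integral hPint _ i) Λ.lα_integral (hdegJ j i)
  · -- non-vanishing determinant
    have hl0 : ((Λ.l : K) ^ L) ≠ 0 :=
      pow_ne_zero _ (by exact_mod_cast (by have := Λ.one_le_l; omega : Λ.l ≠ 0))
    have : Matrix.of q = ((Λ.l : K) ^ L) • Matrix.of fun i j =>
        (kryVec Λ.f Λ.G P (Jsel j) i).eval Λ.α := by
      ext i j; simp [hq, Matrix.smul_apply]
    rw [this, Matrix.det_smul]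
    exact mul_ne_zero (pow_ne_zero _ hl0) hdet
  · -- houses
    rw [hq]
    simp only []
    rw [house_natCast_pow_mul]
    have h := house_eval_le (hwt j i).coeffHouseLE Λ.α (hdegJ j i)
    calc (Λ.l : ℝ) ^ L * house ((kryVec Λ.f Λ.G P (Jsel j) i).eval Λ.α)
        ≤ (Λ.l : ℝ) ^ L * (((L : ℝ) + 1) * W * max 1 (house Λ.α) ^ L) :=
          mul_le_mul_of_nonneg_left (by exact_mod_cast h) (by positivity)
      _ = (Λ.l : ℝ) ^ L * ((L : ℝ) + 1) * W * max 1 (house Λ.α) ^ L := by ring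
  · -- smallness of the forms at `σ₀ α`
    have hexp : ∀ i, ExpBound (σ₀ ∘ Λ.a i) := fun i =>
      expBound_embedding σ₀ (Λ.a i) Λ.C_nonneg (Λ.house_le i)
    have hord : ((M - Jmax : ℕ) : ℕ∞) ≤
        (form (coeAlgHom K) (fun i => egf (Λ.a i)) (kryVec Λ.f Λ.G P (Jsel j))).order := by
      apply le_order_form_dualD_iterate Λ.sol P (Jsel j : ℕ)
      refine le_trans ?_ hPord
      have := hJ_le j
      exact_mod_cast (by omega : M - Jmax + (Jsel j : ℕ) ≤ M)
    have hval := norm_formFun_le σ₀ (hwt j) Λ.C_nonneg Λ.house_le hord Λ.α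
    have hsum : ∑ i, σ₀ (q i j) * eSeries (σ₀ ∘ Λ.a i) (σ₀ Λ.α) =
        σ₀ ((Λ.l : K) ^ L) * formFun σ₀ Λ.a (kryVec Λ.f Λ.G P (Jsel j)) (σ₀ Λ.α) := by
      rw [formFun_apply_embedding, Finset.mul_sum]
      refine Finset.sum_congr rfl fun i _ => ?_
      simp only [hq, map_mul, mul_assoc]
    rw [hsum, norm_mul, map_pow, map_natCast, norm_pow, Complex.norm_natCast]
    exact mul_le_mul_of_nonneg_left hval (by positivity)

end SiegelShidlovskii

end Literature.Barriers.Schanuel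

end
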